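import Literature.RingTheory.CohomologyAnnihilator.AnnihilationOfCohomology
import Literature.RingTheory.CohomologyAnnihilator.ModuleDescentFiniteSubextension
import Literature.AlgebraicGeometry.Resolution.RankOneReductionProofs
import Summits.ResolutionOfSingularities.ResolutionOfSingularities.Theorems.HomologicalConductorStrictDropStationaryRegular
import Summits.ResolutionOfSingularities.ResolutionOfSingularities.Theorems.HomologicalConductorStrictDropTowerShape
import Summits.ResolutionOfSingularities.ResolutionOfSingularities.Theorems.HomologicalConductorNoZenoIffKernel
import HarnessLib

/-!
# Crux `StrictDrop` (stmt-ResolutionOfSingularities-16485), line `birth` — stub `stub_singEqVCa` CLOSED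

Route `ResolutionOfSingularities/HomologicalConductor`, crux #4 `StrictDrop` (along the canonical
normalised cohomology-annihilator blow-up tower `T₀ = loc A`, `T_(m+1) = loc (nrm (chart T_m))` of a
finitely generated `A ⊆ O ⊆ K = Frac A`, while `T_m` is singular some later stage carries a non-zero
annihilator of `O`-value strictly below all of `ca(T_m) ∖ 0`).

The registered skeleton `Cruxes/StrictDrop/Lines/birth.lean` (v4, sha16 `0bb865f43b01e4a8`, 2026-08-17) has
exactly two `sorry`s: the kernel `stub_dichotomy_dimGETwo` and the named Literature fact `stub_singEqVCa`,
whose registered text is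
`Sig.stub_singEqVCa := Literature.RingTheory.CohomologyAnnihilator.singEqVCa_essFiniteType.{0}`
(Iyengar–Takahashi 2014, Thm. 5.4: `V(ca R) = V(ca^{2d+1} R) = Sing R` for localisations `R` of finitely
generated algebras of Krull dimension `d` over any field).  That fact was PROVED in the tree on 2026-08-26
(`Literature.RingTheory.CohomologyAnnihilator.singEqVCa_essFiniteType_holds`,
`Literature/RingTheory/CohomologyAnnihilator/ModuleDescentFiniteSubextension.lean`: reduction to the three
printed inputs, Thm. 3.6 over perfect fields via separable Noether normalisation, Thm. 5.2, and descent of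
a strong generator along `A → K ⊗ₖ A`), so the stub closes BY NAME with its statement verbatim.  After this
file the only `sorry` of the line `birth` is its kernel `stub_dichotomy_dimGETwo` (drop or freeze from a
stage all of whose successors are singular of Krull dimension `≥ 2`), which the skeleton's own
`stub_dichotomy_dimGETwo_of_strictDrop` / `StrictDrop_of` show to be equivalent to the crux.

ADDENDUM (hand leafhand-res-homologicalconduct-3, 2026-08-31; append-only).  The registry entry of the stub now carries
the alias `Sig.stub_singEqVCa` UNFOLDED (same proposition), so `stub_singEqVCa` below is the registered text
verbatim.  New consequences in Birth vocabulary (`NoZeno.Birth.tower`), over EVERY field `k` (the registered SB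
word carries idle `p.Prime` / `CharP k p` binders) and with the fact discharged:
`isRegularLocalRing_of_tower_succ_eq` (a stationary stage is regular), `tower_succ_eq_iff_isRegularLocalRing`
(**STATIONARY ⟺ REGULAR**, with the landed converse `NoZeno.Birth.tower_succ_eq_self_of_isRegularLocalRing`), and
`forall_tower_succ_eq_iff_isRegularLocalRing` (the tower is stationary from stage `m` on iff `T_m` is regular).
So the crux reads: from a singular stage the tower MOVES at every later singular stage, and `StrictDrop` asks for
a later annihilator of strictly smaller `O`-value.

References: S. B. Iyengar, R. Takahashi, *Annihilation of cohomology and strong generation of module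
categories*, IMRN 2016 (arXiv 2014), Thm. 5.4 [`IyengarTakahashi2014`].
-/

noncomputable section

-- single-problem summit: the doubled namespace component `ResolutionOfSingularities` is forced
set_option linter.dupNamespace false

namespace Summit.ResolutionOfSingularities.ResolutionOfSingularities.Theorems.StrictDrop.Birth.SingEqVCa

/-- **Registered stub `stub_singEqVCa` of the line `birth`, CLOSED**: the named Literature fact
Iyengar–Takahashi 2014 Thm. 5.4 (`V(ca R) = V(ca^{2d+1} R) = Sing R` for localisations `R` of finitely
generated algebras of Krull dimension `d` over any field, prime by prime), verbatim the registered text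
`Sig.stub_singEqVCa := Literature.RingTheory.CohomologyAnnihilator.singEqVCa_essFiniteType.{0}`, by the
tree's proof `singEqVCa_essFiniteType_holds`. [cite: IyengarTakahashi2014, Thm. 5.4] -/
theorem stub_singEqVCa : Literature.RingTheory.CohomologyAnnihilator.singEqVCa_essFiniteType.{0} :=
  Literature.RingTheory.CohomologyAnnihilator.singEqVCa_essFiniteType_holds

/-! ## Addendum: stationary ⟺ regular along the tower (Birth vocabulary, every field) -/

open Literature.AlgebraicGeometry.Resolution
open Summit.ResolutionOfSingularities.ResolutionOfSingularities.Theorems.NoZeno.Birth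
open Summit.ResolutionOfSingularities.ResolutionOfSingularities.Theorems.SyzygyFlattening
  (self_le_locAt self_le_nrm isIntegral_of_le)
open Summit.ResolutionOfSingularities.ResolutionOfSingularities.Theorems.HomologicalConductorGlobalisation
  (stub_locEq stub_chartStep stub_nrmStep stub_towerModel)

variable {k K : Type} [Field k] [Field K] [Algebra k K]

/-- **A stationary stage is regular — over EVERY field `k`, unconditionally.** If `T_(n+1) = T_n` along the
canonical normalised `ca`-tower of a finitely generated `A ⊆ O ⊆ K = Frac A`, then `T_n` is a regular local
ring: `T_n` is the localisation at the centre of `O` of a finitely generated model (`stub_towerModel`), hence has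
the tower `Shape`; stationarity makes it contain its `ca`-chart and be integrally closed in `K`, and the landed
`StationaryRegular.isRegularLocalRing_of_frozen` (Krull + `R₁` + Iyengar–Takahashi Thm. 5.4, the latter now the
tree theorem `singEqVCa_essFiniteType_holds` = `stub_singEqVCa` above) concludes.  This is the registered stub SB
(`stub_stationary_regular`) in Birth vocabulary, without its idle `p.Prime`/`CharP k p` binders and with the
named fact discharged. [cite: IyengarTakahashi2014, Thm. 5.4] -/
theorem isRegularLocalRing_of_tower_succ_eq (O : ValuationSubring K) (A : Subalgebra k K) (hA : A.FG)
    (hfr : IsFractionRing ↥A K) (hAO : A.toSubring ≤ O.toSubring) (n : ℕ)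
    (hstat : tower O A (n + 1) = tower O A n) : IsRegularLocalRing ↥(tower O A n) := by
  haveI := hfr
  obtain ⟨Am, hAmfg, hAAm, hAmO, hT⟩ :
      ∃ Am : Subalgebra k K, Am.FG ∧ A ≤ Am ∧ Am.toSubring ≤ O.toSubring ∧
        (tower O A n).toSubring = locAtCentre Am.toSubring O :=
    stub_towerModel stub_locEq stub_chartStep stub_nrmStep O A hA hfr hAO n
  obtain ⟨⟨B, hBfg, -, hlocB, -⟩, hNoeth, hTO, -⟩ :=
    TowerShape.shape_of_toSubring_eq_locAtCentre O Am (tower O A n) hAmfg hAmO hT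
  -- `Frac T_n = K` since `A ≤ Am ≤ T_n`
  have hAmT : Am ≤ tower O A n := fun x hx => by
    have h : x ∈ locAtCentre Am.toSubring O := le_locAtCentre Am.toSubring O hx
    rw [← hT] at h
    exact h
  have hfracT : IsFractionRing ↥(tower O A n) K :=
    isFractionRing_subalgebra_of_le A (tower O A n) (hAAm.trans hAmT)
  -- frozen: `T_n ≤ chart T_n ≤ nrm (chart T_n) ≤ loc (nrm (chart T_n)) = T_(n+1) = T_n`
  have hTc : tower O A n ≤ chart O (tower O A n) := fun y hy => Algebra.subset_adjoin (Or.inl hy)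
  have hcT : chart O (tower O A n) ≤ tower O A n := by
    intro y hy
    have h₁ : y ∈ tower O A (n + 1) := by
      rw [tower_succ]
      exact self_le_locAt O _ (self_le_nrm _ hy)
    rwa [hstat] at h₁
  have hint : ∀ y : K, IsIntegral ↥(tower O A n) y → y ∈ tower O A n := by
    intro y hy
    have h₁ : y ∈ nrm (chart O (tower O A n)) := Algebra.subset_adjoin (isIntegral_of_le hTc hy)
    have h₂ : y ∈ tower O A (n + 1) := by
      rw [tower_succ]
      exact self_le_locAt O _ h₁
    rwa [hstat] at h₂
  exact StationaryRegular.isRegularLocalRing_of_frozen stub_singEqVCa O B (tower O A n) hBfg hlocB hTO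
    hfracT hNoeth hcT hint

/-- **STATIONARY ⟺ REGULAR along the canonical tower** (every field `k ⊆ O`): `T_(n+1) = T_n` iff `T_n` is a
regular local ring — `isRegularLocalRing_of_tower_succ_eq` with the landed converse
`NoZeno.Birth.tower_succ_eq_self_of_isRegularLocalRing` (a regular stage has `ca = ⊤`, so the chart, the
normalisation and the localisation change nothing).  Hence the crux `StrictDrop` reads: from a singular stage
the tower MOVES, and some later stage carries an annihilator of strictly smaller `O`-value than all of
`ca(T_m) ∖ 0`. [cite: IyengarTakahashi2014, Thm. 5.4 and Example 2.5] -/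
theorem tower_succ_eq_iff_isRegularLocalRing (O : ValuationSubring K) (A : Subalgebra k K)
    (hk : ∀ c : k, algebraMap k K c ∈ O) (hA : A.FG) (hfr : IsFractionRing ↥A K)
    (hAO : A.toSubring ≤ O.toSubring) (n : ℕ) :
    tower O A (n + 1) = tower O A n ↔ IsRegularLocalRing ↥(tower O A n) :=
  ⟨isRegularLocalRing_of_tower_succ_eq O A hA hfr hAO n,
    tower_succ_eq_self_of_isRegularLocalRing O A hk hfr hAO n⟩

/-- **The tower is stationary from a regular stage on, and only from one**: `(∀ n ≥ m, T_(n+1) = T_n) ↔ T_m`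
regular (regularity propagates because a stationary tower repeats the regular stage). [folklore] -/
theorem forall_tower_succ_eq_iff_isRegularLocalRing (O : ValuationSubring K) (A : Subalgebra k K)
    (hk : ∀ c : k, algebraMap k K c ∈ O) (hA : A.FG) (hfr : IsFractionRing ↥A K)
    (hAO : A.toSubring ≤ O.toSubring) (m : ℕ) :
    (∀ n : ℕ, m ≤ n → tower O A (n + 1) = tower O A n) ↔ IsRegularLocalRing ↥(tower O A m) := by
  refine ⟨fun h => (tower_succ_eq_iff_isRegularLocalRing O A hk hA hfr hAO m).mp (h m le_rfl),
    fun hreg n hmn => ?_⟩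
  induction n, hmn using Nat.le_induction with
  | base => exact tower_succ_eq_self_of_isRegularLocalRing O A hk hfr hAO m hreg
  | succ n hmn ih =>
    have hreg_n : IsRegularLocalRing ↥(tower O A n) :=
      (tower_succ_eq_iff_isRegularLocalRing O A hk hA hfr hAO n).mp ih
    have hreg_s : IsRegularLocalRing ↥(tower O A (n + 1)) := by rw [ih]; exact hreg_n
    exact tower_succ_eq_self_of_isRegularLocalRing O A hk hfr hAO (n + 1) hreg_s

end Summit.ResolutionOfSingularities.ResolutionOfSingularities.Theorems.StrictDrop.Birth.SingEqVCa

end
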